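import Mathlib
import HarnessLib
import Literature.AlgebraicGeometry.Resolution.RsopMonomialIdeals
import Summits.ResolutionOfSingularities.ResolutionOfSingularities.Theorems.WildQuotientsWildQuotientResolutionKSCentreStepPClosed

/-!
# Kollár–Szabó going down along a regular stable centre: the step in `IsRsopPart` currency
# (crux `WildQuotients.WildQuotientResolution`, stub `stub_phaseZeroHighDim`)

Crux stmt-ResolutionOfSingularities-15640 (`WildQuotientResolution`), registered stub `stub_phaseZeroHighDim`;
programme PHASE0-KS-EIGENLINE, item (K2-centres). Convenience restatements of hand 8-g3's step theorems
✓`CentreChart.exists_fixedPoint_liftAction_step_of_regularCentre(_of_normal_isPGroup)` (p831389 / p831632) with the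
regular-centre hypothesis in the tree's standard currency `IsRsopPart` (`RsopMonomialIdeals.lean`: the generators
`z` of `I_x` are PART OF A REGULAR SYSTEM OF PARAMETERS of `𝒪_{X,x}` — e.g. obtained from
✓`IsRsopPart.of_isRegularLocalRing_quotient` when `𝒪_{X,x}/I_x` is regular of the right dimension), via
✓`IsRsopPart.exists_rsop`:

* `exists_fixedPoint_liftAction_step_of_isRsopPart` (abelian stabiliser),
* `exists_fixedPoint_liftAction_step_of_isRsopPart_of_normal_isPGroup` (p-closed stabiliser).

[OURS · crux stmt-ResolutionOfSingularities-15640 · helper toward `stub_phaseZeroHighDim` ((K2-centres) step, `IsRsopPart`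
form; NOT a proof of the stub); counted 0; AI-level work, weaker than expert review.]
[cite: ReichsteinYoussin2000, Appendix (Kollár–Szabó), proof of Prop. A.2]
-/

-- single-problem summit: the doubled namespace component `ResolutionOfSingularities` is forced
set_option linter.dupNamespace false

noncomputable section

open CategoryTheory CategoryTheory.Limits AlgebraicGeometry TopologicalSpace IsLocalRing
open Literature.AlgebraicGeometry.Ramification Literature.AlgebraicGeometry.Resolution
open Scheme.IdealSheafData
open Summit.ResolutionOfSingularities.ResolutionOfSingularities.Theorems.WildQuotientResolution

namespace Summit.ResolutionOfSingularities.ResolutionOfSingularities.Theorems.WildQuotientResolution.CentreChart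

/-- **The Kollár–Szabó step along a regular stable centre, `IsRsopPart` form (abelian stabiliser).** As
✓`exists_fixedPoint_liftAction_step_of_regularCentre`, with the centre given by generators `z` of `I_x` forming part
of a regular system of parameters of `𝒪_{X,x}`. [cite: ReichsteinYoussin2000, Appendix (Kollár–Szabó), proof of Prop. A.2] -/
theorem exists_fixedPoint_liftAction_step_of_isRsopPart {X : Scheme.{0}} [IsIntegral X]
    [IsLocallyNoetherian X] {G : Type} [CommGroup G] (σ : G →* Aut X) {x : X} (hxc : IsClosed ({x} : Set X))
    (hGx : ∀ g, g ∈ inertiaSubgroup σ x)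
    [IsRegularLocalRing (X.presheaf.stalk x)] [IsAlgClosed (ResidueField (X.presheaf.stalk x))]
    {I : X.IdealSheafData} (hI : ∀ g, I.comap (σ g).hom = I)
    {m : ℕ} (z : Fin m → X.presheaf.stalk x) (hz : IsRsopPart z)
    (hIx : stalkIdeal I x = Ideal.span (Set.range z)) (hIx0 : stalkIdeal I x ≠ ⊥) (hI0 : I ≠ ⊥)
    {X' : Scheme.{0}} {π : X' ⟶ X} (hπ : IsBlowup π I) :
    IsIntegral X' ∧ IsLocallyNoetherian X' ∧
    ∃ x' : X', π x' = x ∧ IsClosed ({x'} : Set X') ∧ (∀ g, g ∈ inertiaSubgroup (hπ.liftAction σ hI) x') ∧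
      IsRegularLocalRing (X'.presheaf.stalk x') ∧ IsAlgClosed (ResidueField (X'.presheaf.stalk x')) ∧
      ringKrullDim (X'.presheaf.stalk x') = ringKrullDim (X.presheaf.stalk x) := by
  obtain ⟨e', xs, hd, hxs, hxz⟩ := hz.exists_rsop
  have hcomp : xs ∘ Fin.castAdd e' = z := funext hxz
  exact exists_fixedPoint_liftAction_step_of_regularCentre σ hxc hGx hI hd xs hxs (Fin.castAdd e')
    (Fin.castAdd_injective _ _) (by rw [hcomp]; exact hIx) hIx0 hI0 hπ

/-- **The Kollár–Szabó step along a regular stable centre, `IsRsopPart` form (p-closed stabiliser `G ⊵ P ⊇ [G,G]`).**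
[cite: ReichsteinYoussin2000, Appendix (Kollár–Szabó), Lemma A.1 and proof of Prop. A.2] -/
theorem exists_fixedPoint_liftAction_step_of_isRsopPart_of_normal_isPGroup {X : Scheme.{0}} [IsIntegral X]
    [IsLocallyNoetherian X] {G : Type} [Group G] [Finite G] {p : ℕ} [Fact p.Prime]
    (P : Subgroup G) [P.Normal] (hP : IsPGroup p P) (hcomm : ∀ g h : G, g * h * g⁻¹ * h⁻¹ ∈ P)
    (σ : G →* Aut X) {x : X} (hxc : IsClosed ({x} : Set X))
    (hGx : ∀ g, g ∈ inertiaSubgroup σ x)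
    [IsRegularLocalRing (X.presheaf.stalk x)] [CharP (ResidueField (X.presheaf.stalk x)) p]
    [IsAlgClosed (ResidueField (X.presheaf.stalk x))]
    {I : X.IdealSheafData} (hI : ∀ g, I.comap (σ g).hom = I)
    {m : ℕ} (z : Fin m → X.presheaf.stalk x) (hz : IsRsopPart z)
    (hIx : stalkIdeal I x = Ideal.span (Set.range z)) (hIx0 : stalkIdeal I x ≠ ⊥) (hI0 : I ≠ ⊥)
    {X' : Scheme.{0}} {π : X' ⟶ X} (hπ : IsBlowup π I) :
    IsIntegral X' ∧ IsLocallyNoetherian X' ∧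
    ∃ x' : X', π x' = x ∧ IsClosed ({x'} : Set X') ∧ (∀ g, g ∈ inertiaSubgroup (hπ.liftAction σ hI) x') ∧
      IsRegularLocalRing (X'.presheaf.stalk x') ∧ IsAlgClosed (ResidueField (X'.presheaf.stalk x')) ∧
      ringKrullDim (X'.presheaf.stalk x') = ringKrullDim (X.presheaf.stalk x) := by
  obtain ⟨e', xs, hd, hxs, hxz⟩ := hz.exists_rsop
  have hcomp : xs ∘ Fin.castAdd e' = z := funext hxz
  exact exists_fixedPoint_liftAction_step_of_regularCentre_of_normal_isPGroup P hP hcomm σ hxc hGx hI hd xs hxs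
    (Fin.castAdd e') (Fin.castAdd_injective _ _) (by rw [hcomp]; exact hIx) hIx0 hI0 hπ

end Summit.ResolutionOfSingularities.ResolutionOfSingularities.Theorems.WildQuotientResolution.CentreChart

end
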